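import Mathlib
import HarnessLib
import HarnessLib.Audit
import Summits.AtomisticToContinuum.Statement
import Literature.MathematicalPhysics.QuantumManyBody.PeriodicBoseGas

/-!
Route: NumberFilterBlindness

CLOSED (retired) 2026-08-15T13:44:58Z by operator:999:1257524 — reason: not-a-thesis: assembly does not conclude the sub-problem Statement — note: D-0027 §2.1 audit (human 2026-08-15: routes that do not decide the summit are removed): the assembly concludes `JosephsonScaleBlindness`, not the sub-problem statement; a NEW conforming route may be opened from the same idea (generated `closes : … → _root_.BoseEinsteinCondensation`).. The file is kept as the record of this route; refuted decls are indexed as negative knowledge (`ledger negatives`).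

# Route NumberFilterBlindness — number filter f(Σχ(xⱼ))·Ψ — energy within C·N/L² of E₀ cannot
certify λ_max ≥ cN (barrier route, Josephson scale)

BARRIER ROUTE (negative knowledge, D-0021), realising card number-filter-energy-blindness. Declared
up front: X does NOT
imply the conjunct and is not claimed to; the Assembly concludes in X (precedent:
AnomalousDissipation/TaylorResolutionBarrier).
"It suffices to show X" = JosephsonScaleBlindness: for every repulsive finite-range v and every c >
0 there are C and ρ₀ > 0
(C independent of ρ and N) such that for 0 < ρ < ρ₀ and all large N the Dirichlet box of side L =
(N/ρ)^{1/3} carries an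
admissible trial state Φ with ⟨Φ, H_N Φ⟩ ≤ E₀(N, L) + C·N/L² and λ_max(γ_Φ) ≤ cN. In words: energy
information coarser than the
Josephson scale N/L² = ρ^{2/3}N^{1/3} (in particular LHY precision o(ρa√(ρa³))N, every extensive
slack, every N^{1/3+ε} slack)
cannot certify macroscopic occupation of ANY mode — the mode-free (λ_max) form, which unitary
phase-texture witnesses cannot reach.
X = A ∘ B: A = FilterFragmentation (the number filter: a positive configuration-space multiplier F =
Π_c f_{k_c}(Σ_j χ_c(x_j)),
windows of width < 1 in each smooth cell count, exact IMS cost Σ_k|∇F_k|²|Ψ|² ≤ C K² N/L², exact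
vanishing of inter-cell coherence;
scale-free and model-free, constants depend on c only) and B = NearMinimiserSlabConcentration (some
N/L²-near-minimiser has
concentrated macroscopic slab counts; Lieb–Yngvason cell convexity, leading order only). The
positive face
JosephsonSlackCondensation (all κN/L²-near-minimisers condense; it implies the conjunct via the
support item
SlackCondensationToBEC) is filed to mark the exact threshold and is NOT used by the Assembly.
Lean: `∀ v : ℝ → ENNReal,
Literature.MathematicalPhysics.QuantumManyBody.BoseGas.IsRepulsiveFiniteRange v → ∀ c : ℝ, 0 < c → ∃
C ρ₀ : ℝ, 0 < ρ₀ ∧ ∀ ρ : ℝ, 0 < ρ → ρ < ρ₀ → ∀ᶠ N : ℕ in Filter.atTop, ∃ Φ :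
Literature.MathematicalPhysics.QuantumManyBody.BoseGas.TrialState N
(Literature.MathematicalPhysics.QuantumManyBody.BoseGas.sideLength ρ N),
Literature.MathematicalPhysics.QuantumManyBody.BoseGas.energy v Φ ≤
Literature.MathematicalPhysics.QuantumManyBody.BoseGas.groundStateEnergy v N
(Literature.MathematicalPhysics.QuantumManyBody.BoseGas.sideLength ρ N) + ENNReal.ofReal (C * N /
Literature.MathematicalPhysics.QuantumManyBody.BoseGas.sideLength ρ N ^ 2) ∧
Literature.MathematicalPhysics.QuantumManyBody.BoseGas.maxOccupation N Φ.ψ ≤ ENNReal.ofReal (c * N)`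

## Assembly
FilterFragmentation → NearMinimiserSlabConcentration → JosephsonScaleBlindness: given v and c take
K(c), C_A(c) from A and
ρ₀(v, K) from B; for ρ < ρ₀ and large N (N ≥ 1, so L > 0) B hands a Ψ with slack N/L² and
concentrated slab counts, A returns
Φ with slack 4N/L² + C_A N/L² and λ_max ≤ cN; C := 4 + C_A. Pure logic plus ENNReal arithmetic —
PROVED sorry-free in the
folder's Sketch.lean (theorem assembly_holds, 20 lines; a prover re-proves it in Theorems/). NOT an
implication to the conjunct
(barrier route); the conjunct-facing glue is the support item SlackCondensationToBEC.

Rationale: WHY THIS LINE. Mechanism: Lieb–Solovej number localisation (LiebSolovej2001 = LSSY2005 Thm 10.6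
p.105: restricting an approximate ground state
to a window of M values of a number operator costs C/M² × off-diagonal energy) and the IMS
localisation formula (CyconEtAl1987
Thm 3.2; Lewin2011 §3 geometric localisation) are run BACKWARDS — not to localise n₊ and use the
energy, but to localise the
relative number of macroscopic cells and defeat it: a window of width < 1 in the smooth count Σ_j
χ_c(x_j) makes the
one-particle density matrix of the filtered state vanish identically between cell interiors
(number–phase conjugacy of
fragmentation, MuellerEtAl2006 §II, Leggett2001 §VI; explicit dictionary: window width ↔
relative-number uncertainty,
∫|∇F|²|Ψ|² ↔ Josephson coupling energy ∝ N/L²), at the exact price of the pointwise IMS identity,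
O(K²N/L²) for K slabs.
Imported areas: spectral-theory localisation (IMS/geometric localisation) and two-mode condensate
physics; the only property of
the unknown near-minimiser that is needed — concentration of macroscopic slab counts — comes from
the Lieb–Yngvason cell
convexity, PROVED in the tree (LSSY2005_lowerBound_dirichlet_holds, LSSY2005_boxLowerBound_holds,
sum_locGroundStateEnergy_mul_le_setLIntegral_cellSet, LSSY2005_upperBound_periodic_holds), so no
LHY-order input enters.
What it does that prior items do not: PhaseTwistObstruction (stmt-AtomisticToContinuum-0852) and
card
energy-blindness-bessel-witness are v = 0 / fixed-mode witnesses (a phase e^{iΣθ(x_j)} is unitary on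
γ, so λ_max is untouched and
that card's mode-free item W3 needs an unproved law of large numbers); the filter is per-v,
interacting and mode-free with no
LLN, and it quantifies the threshold: slack C(c)N/L² fragments, so an energy-only crux must carry
slack κN/L² with κ below a
v-dependent constant (BECPinning's δ = κN/4L² passes; any Δ_N ≫ N^{1/3} is dead on arrival), and
Junge2026's reach
a(ρa³)^{-3/4} (where C·N/L² equals LHY precision) is the intrinsic limit of energy localisation, not
Neumann bookkeeping.

RANKED CRUXES. #0 JosephsonScaleBlindness (target) — X as in § Thesis: per v (repulsive, finite
range) and per c > 0, constants C (independent of ρ, N) and ρ₀ such that for ρ < ρ₀ and all large N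
some Dirichlet trial state on the box of side (N/ρ)^{1/3} has energy ≤ E₀ + C·N/L² and λ_max(γ) ≤ cN
(card item N1, mode-free form). (why it might fail: C must not depend on ρ: if the slab-count
concentration of near-minimisers forced a ρ-dependent filter geometry the bound would degrade to
C(ρ)N/L² ~ N^{1/3+}; for v = 0 X holds by explicit product states, so only the interacting
uniformity can fail.) [LSSY2005, LiebSolovej2001, Junge2026, Fournais2020, MuellerEtAl2006]
#2 FilterFragmentation (crux) — THE NUMBER-FILTER LEMMA (card mechanism; scale-free, model-free).
For every c > 0 there are K ∈ ℕ and C ≥ 0 such that for every repulsive finite-range v, every N,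
every L > 0 and every Dirichlet trial state Ψ on Λ_L whose slab counts are concentrated — the
|Ψ|²-probability that one of the K slabs {x : x₁ ∈ [iL/K,(i+1)L/K)} holds more than 4N/K particles
is ≤ 1/K² — and every slack δ with ⟨Ψ,HΨ⟩ ≤ E₀(N,L) + δ, there is a Dirichlet trial state Φ with
⟨Φ,HΦ⟩ ≤ E₀(N,L) + 4δ + C·N/L² and λ_max(γ_Φ) ≤ cN. Construction: M = ⌈12/c⌉ cells (blocks of slabs)
separated by single-slab layers, smooth partition χ_c (Σ_c χ_c = 1, |∇χ_c| ≤ C₀K/L), smooth counts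
Ñ_c = Σ_j χ_c(x_j), joint filter F_k = Π_c f_{k_c}(Ñ_c) with Σ_k f_k² = 1, supp f_k of width 0.9 <
1, Σ_k f_k'² bounded; pointwise IMS: Σ_k |∇(F_kΨ)|² = |∇Ψ|² + (Σ_k|∇F_k|²)|Ψ|², Σ_k|∇F_k|² ≤ C
K²N/L²; Markov selection of one window k (excess energy ≤ 4(δ + cost): weight 1/4; layer load ≤
4·E_Ψ: weight 1/4; unbalanced windows: weight ≤ 1/K²); in Φ = F_kΨ/‖F_kΨ‖ the coherence between
distinct cell interiors vanishes identically (f(n)f(n+1) = 0, pointwise in the other coordinates),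
cell loads are ≤ cN/2 on the support, layer load ≤ εN in mean, hence ⟨φ,γ_Φ φ⟩ ≤ (√(cN/2)·‖φ_cells‖
+ √(εN)·‖φ_layers‖)² ≤ cN by Cauchy–Schwarz per block and Minkowski. [difficulty: L] (why it might
fail: λ_max is bounded through the cell/layer LOADS of Φ: windows pin cell loads pointwise but layer
loads only via Markov, jointly with the energy excess and window balance (weights 1/4+1/4+K⁻²<1); if
the layer population could not be made ≤ εN at width L/K for concentrated Ψ, c < 4ε is out of
reach.) [LiebSolovej2001, LSSY2005, CyconEtAl1987, Lewin2011, MuellerEtAl2006, Leggett2001]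
#3 NearMinimiserSlabConcentration (crux) — For every repulsive finite-range v and every K ≥ 1 there
is ρ₀ > 0 such that for 0 < ρ < ρ₀ and all large N there is a Dirichlet trial state Ψ on the box of
side L = (N/ρ)^{1/3} with ⟨Ψ,HΨ⟩ ≤ E₀ + N/L² whose slab counts are concentrated in the sense of
FilterFragmentation (|Ψ|²-probability that some slab of width L/K along x₁ holds > 4N/K particles is
≤ 1/K²). Route to it: for a > 0, ANY Ψ with slack N/L² has energy ≤ 4πaρN(1+ε) (DirichletUpperBound;
N/L² = o(ρaN)), while the state-level cell decomposition into K³ Neumann cubes of side ℓ = L/K (in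
tree: sum_locGroundStateEnergy_mul_le_setLIntegral_cellSet pattern) gives energy ≥ E_Ψ[Σ_cubes
E₀^Neu(n_c, ℓ)] with, per cube, LSSY Thm 2.4 in Neumann form (LSSY2005_lowerBound_neumann_holds: 4πa
n_c²/ℓ³(1 − CY_c^{1/17}) for n_min ≤ n_c ≤ Dn̄), superadditivity blocks for n_c > Dn̄
(LSSY2005_superadditivity.mul_le) and E₀ ≥ 0 for n_c < n_min ~ (ℓ/a)^{1/6} ≪ n̄ = N/K³; subtracting
the tangent at n̄ leaves a Huber-type deviation Σ_c E_Ψ min((n_c−n̄)², Dn̄|n_c−n̄|) ≤ C(ε + Y^{1/17}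
+ o(1))·N n̄, and Chebyshev gives the slab statement once C(ε + Y^{1/17})K⁵ is small (ρ < ρ₀(K, v),
N large); for a = 0 (v = 0 a.e., free functional) take the sine-product ground state and binomial
concentration. [deps: DirichletUpperBound] [difficulty: L] (why it might fail: Needs E₀^Dir ≤
4πaρN(1+o(1)) (only periodic Thm 2.2 is in tree), a SECOND-MOMENT form of the LY cell bound incl.
cubes with n ≫ p particles (superadditivity blocks) and the a = 0 reduction; false if
near-minimisers at slack N/L² can be Schrödinger cats of macroscopically different profiles.)
[LSSY2005, LiebYngvason1998, Dyson1957, LiebSeiringerSolovejYngvason2005]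
#5 JosephsonSlackCondensation (crux) — POSITIVE FACE of the dichotomy (not used by the Assembly):
for every repulsive finite-range v there is ρ₀ > 0 such that for 0 < ρ < ρ₀ there are c, κ > 0 with:
for all large N, EVERY Dirichlet trial state Ψ on the box of side L = (N/ρ)^{1/3} with ⟨Ψ,HΨ⟩ ≤ E₀ +
κN/L² has λ_max(γ_Ψ) ≥ cN. Together with X this pins the threshold of energy-only condensation
criteria at exactly the Josephson scale (κ small: condensation; C(c) large: fragmentation). Implied
by BECPinning.PinnedLowerBound; implies the conjunct (SlackCondensationToBEC). Filed so that future
energy-currency routes attach to ONE deduplicated statement of the right shape. [difficulty: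
open-problem] (why it might fail: It is thermodynamic-limit BEC uniformly over all
κN/L²-near-minimisers — stronger than the conjunct (δ chosen after N); no kinetic gap survives L → ∞
(ChongLiangNam2026 §1), and a soft non-phonon branch re-condensing ⊥ the condensate at cost o(N/L²)
would refute every κ > 0.) [Junge2026, FournaisEtAl2024, LiebSeiringer2002,
NamRougerieSeiringer2016, ChongLiangNam2026, LSSY2005]
#9 SlackCondensationToBEC (support) — JosephsonSlackCondensation → BoseEinsteinCondensation: with δ
:= ofReal(κN/L²) > 0 (N ≥ 1) apply
Literature.MathematicalPhysics.QuantumManyBody.BoseGas.le_condensateNumber to get ofReal(cN) ≤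
condensateNumber, i.e. HasGroundStateBEC v ρ with the same c (~30 lines). [difficulty: provable-now]
[LSSY2005, LiebSeiringerSolovejYngvason2005]
#9 DirichletUpperBound (support) — Leading-order Dirichlet upper bound in the thermodynamic limit:
for repulsive finite-range v with 0 < a < ∞ (a = scattering length) and every ε > 0 there is ρ₀ > 0
such that for 0 < ρ < ρ₀ and all large N, E₀^Dir(N, (N/ρ)^{1/3}) ≤ 4πaρN(1+ε). From the in-tree
periodic Thm 2.2 (LSSY2005_upperBound_periodic_holds: 4πρ₁a(1 + C a/b), a/b ~ (ρa³)^{1/3}) or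
directly from Dyson's trial state, times a product boundary cutoff Π_j h(x_j) vanishing on ∂Λ (h = 1
at distance b = o(L) from the walls): the cutoff costs O(N/(bL) + Nb/L)·(ρa) = o(N) relative — LSSY
(2.8): e₀(ρ) is independent of boundary conditions. [difficulty: M] [LSSY2005, Dyson1957,
LiebSeiringerSolovejYngvason2005]

TWO-LAYER PLAN. B ⇐ DirichletUpperBound → CellCountConcentration → B, where CellCountConcentration =
for a > 0 every Ψ with energy
≤ 4πaρN(1+ε) has Σ_cubes E_Ψ min((n_c − n̄)², Dn̄|n_c − n̄|) ≤ C(ε + Y^{1/17})·N·n̄ over K³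
macroscopic Neumann cubes (Thm 2.4 per
cube + superadditivity + tangent subtraction: the convexity remainder LSSY's (2.52)–(2.57) discard,
kept); the a = 0 case rides as a
`--supports` lemma. A ⇐ FilterTrialState (closure of TrialState under F = Π_c f(Σ_jχ_c(x_j))
with the pointwise IMS identity Σ_k kineticDensity(F_kΨ) = kineticDensity Ψ + (Σ_k|∇F_k|²)|Ψ|²) →
BlockOccupationBound
(occupation of any normalised φ in a width-<1 filtered state ≤ (√(max cell load)·‖φ_cells‖ + √(layer
load)·‖φ_layers‖)²) → A.
Foreseen sharpenings, deliberately not filed: the periodic twin of X (audits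
PeriodicPinnedLowerBound / PeriodicBEC-type items);
a box-uniform version of X on L ≥ a(ρa³)^{-3/4-s} (Junge-exponent optimality in GP-type windows);
the catalogue entry
Literature/Barriers/AtomisticToContinuum/JosephsonScaleEnergyBlindness vendored from the Theorems
file once X lands.

KILL CRITERIA. X is a theorem-candidate, so the realistic kill is ¬NearMinimiserSlabConcentration
for some admissible v (near-minimisers at
slack N/L² with macroscopic number fluctuations at every small ρ): close
`refuted:NearMinimiserSlabConcentration` unless the
refutation is an artefact of the ∃Ψ/threshold constants (then restate with 4N/K → AN/K), and hand
the witness to the positivity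
cards as a remarkable rigidity failure; the fallback line is the periodic setting with translation
averaging. ¬FilterFragmentation
would mean inter-cell coherence survives width-<1 windows, contradicting a pointwise identity — if a
refuter nevertheless produces
it, the card is dead: close `refuted:FilterFragmentation`. JosephsonSlackCondensation refuted ⇒
negative knowledge against every
pinning/penalty route at every κ (BECPinning's own kill criterion); the barrier part is unaffected
and stays open. X proved by
other means (Bessel textures + an LLN for |Ψ₀|²) moots A/B but fulfils the route.

NOT DECOMPOSED YET. Constants K(c) ≈ 10³/c², C(c) ≈ 10²·K(c)² (not optimised; X only asserts
existence); the C¹/TrialState closure and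
normalisation of filtered states; measurability of the slab-count event; the second-moment LY
bookkeeping and the a = 0
reduction (scatteringLength v = 0 ⇒ v = 0 a.e. ⇒ free energy functional); the cutoff construction
behind DirichletUpperBound;
ScatteringLengthFinite (stmt-AtomisticToContinuum-0851, shared with BECPinning). No second-order
(LHY) energy input is used
anywhere — by design the line needs only leading-order asymptotics, which the tree already proves.

CHEAPEST FALSIFIER. Free gas v = 0 (admissible: IsRepulsiveFiniteRange 0): E₀ = 3π²N/L² and the
symmetrised product of M = ⌈1/c⌉ orthogonal low
Dirichlet modes with N/M particles each has energy ≤ E₀ + C·M^{2/3}N/L² and λ_max = N/M ≤ cN, so X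
holds there with
C(c) ≈ 40c^{-2/3} — consistent; and the same free gas shows JosephsonSlackCondensation needs κ <
3π²(1−c) (gap), also consistent.
The one lookup that would grade the route `known`: a printed theorem 'approximate ground states of
the 3-D dilute interacting gas
with N^{1/3+}-excess energy need not condense (λ_max/N → 0)' — searched 2026-08-15 (Novelty), not
found; the barrier audit of
EnergyAsymptoticsWithoutCondensationNarrow records 'in d = 3 no model separates LHY-order energy
validity from BEC'. I ran the
logic check myself: Sketch.lean elaborates (rc 0) and the Assembly is proved there.

NUMBERS. N/L² = ρ^{2/3}N^{1/3}. LHY precision ρa(ρa³)^{1/2}·N equals C·N/L² at L* = √C·a(ρa³)^{-3/4}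
= √C·ξ(ρa³)^{-1/4}, ξ = (ρa)^{-1/2}:
Junge2026 Cor. 6 / Remark 7 reach a(ρa³)^{-3/4-η}; Fournais2020 Thm 1.2 boxes
C(ρa³)^{-δ}(ρa)^{-1/2}; LSSY Thm 5.1 (KineticGapLengthScales)
ρaL² = const. Free Dirichlet gap 3π²/L²; BECPinning's recorded envelope κ(1 − C√(ρa³)) ≤ 4π²
(periodic boost). LY Thm 2.4:
relative error CY^{1/17}, boxes L/a > C'Y^{-6/17} (in tree). Filter bookkeeping: window width 0.9,
overlap 0.3, Σ_k f_k'² ≲ 30,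
M = ⌈12/c⌉ cells, layer fraction ε ≤ 0.085c, K ≥ 141M/c. LSSY2005 Thm 10.6 (p.105): cost C M⁻²
Σ_{k<M} k²|d_k| + C Σ_{k≥M}|d_k| —
the 1/w² law of the filter. Items at open: 7.

DEFINITION REQUESTS. None. All items are typed over
Literature.MathematicalPhysics.QuantumManyBody.BoseGas.{TrialState, Config, energy,
groundStateEnergy, maxOccupation, sideLength, IsRepulsiveFiniteRange, scatteringLength,
BoseEinsteinCondensation} (lean search
--decl: BoseEinsteinCondensation.lean, PeriodicBoseGas.lean); slab counts are inlined as
`(Finset.univ.filter fun j => X j 0 ∈ Set.Ico (iL/K) ((i+1)L/K)).card`. A small `slabCount` /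
smooth-count API would shorten A and B
— a prover's `--supports` lemma, not a definition item.

Novelty: Searches (2026-08-15): `lit frontier AtomisticToContinuum --since 2021` (30 rows; BEC descendants
arXiv:2603.20776, arXiv:2510.20493,
arXiv:2602.16566 — none on fragmentation witnesses); `lit bridges AtomisticToContinuum --cross any`
(30 rows, nothing specific);
`lit search --hybrid "localization of large matrices number of particles window"` (8; →
book:lieb2005-mathematics-bose-gas-its-condensation
p.105 Thm 10.6, read) and `--hybrid "geometric localization Fock space smooth partition of unity
particles in a ball"` (8; → same book
pp.101–103); `lit search --source zbmath "Geometric methods for nonlinear many-body quantum systems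
Lewin"` (1: doi:10.1016/j.jfa.2010.11.017 =
arXiv:1009.2836), `--source zbmath "fragmented condensate energy cost number fluctuations bosons two
modes"` (0), `--source zbmath
"Lieb Solovej charged Bose gas"` (8; → doi:10.1007/s002200000353); `--source crossref "geometric
localization Fock space many-body bosons …"`
(10, many-body-localisation physics only); openalex / arXiv HTTP 429; `lit galaxy search "fragmented
condensate energy cost superselection …"
--star all` and `"IMS localization formula partition of unity particle number many-body" --star all`
(galaxyd queued too long, 0 rows);
`ledger negatives --problem AtomisticToContinuum` (0); in tree: BECPinning
stmt-AtomisticToContinuum-0852, card energy-blindness-bessel-witness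
(audit-6: variant) and this card's audit-15 (new-combination).
Nearest prior art found: LiebSolovej2001 (= LSSY2005 Thm 10.  [refs: 10.1016/j.jfa.2010.11.017, 10.1007/s002200000353, 2603.20776, 2510.20493, 2602.16566, 1009.2836, book:lieb2005-mathematics-bose-gas-its-condensation, doi:10.1016/j.jfa.2010.11.017, doi:10.1007/s002200000353, LiebSolovej2001, LSSY2005, CyconEtAl1987, Lewin2011, LiebSeiringer2002, NamRougerieSeiringer2016]

Barriers (technique_class: negative-witness number-filter josephson-scale): - technique_class: negative-witness number-filter josephson-scale
- Literature.Barriers.AtomisticToContinuum.EnergyAsymptoticsWithoutCondensation: not evaded —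
EXTENDED: the entry's witness is 1-D (Lieb–Liniger: Bogoliubov's energy right to two orders without
BEC); X is the 3-D, in-class, per-v quantitative version with threshold N/L², to be vendored as a
new entry JosephsonScaleEnergyBlindness.
- Literature.Barriers.AtomisticToContinuum.EnergyAsymptoticsWithoutCondensationNarrow: consistent
with its scope note (d = 3 energy inferences with extra infrared structure are not excluded): X
states exactly how much extra structure is needed — slack below C(c)N/L², or non-energetic input
(positivity, eigen-equation, response/pinning at strength κ/L²).
- Literature.Barriers.AtomisticToContinuum.KineticGapLengthScales: explained, not evaded: gap
methods turn L² × (excess energy per particle) into depletion; X shows the conversion is void once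
the excess exceeds C/L² per particle, i.e. beyond L* = a(ρa³)^{-3/4} at LHY precision — the entry's
length-scale limitation is intrinsic to energy information.
- Literature.Barriers.AtomisticToContinuum.CasimirBoxGeneralizedCondensation: same moral at T = 0
with interactions: the filtered states are 'fragmented/generalised condensates' manufactured at will
below energy resolution N/L².
- Literature.Barriers.AtomisticToContinuum.SymmetryBreakingWithoutCondensate: not engaged
(canonical, first-quantised, no source field).
- Negatives index: empty a

History (route lifecycle, newest last):
- 2026-08-15T13:44:59Z · CLOSED retired — not-a-thesis: assembly does not conclude the sub-problem Statement (operator:999:1257524)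

sub-problem: BoseEinsteinCondensation · status: closed(retired) · opened planner-plancard-AtomisticToContinuum-BoseEin-e6a487b2-0 2026-08-15T11:44:07Z · rev 0 · ledger route-AtomisticToContinuum-NumberFilterBlindness
GENERATED by the gate from the ledger (D-0016/17). Provers cite these decls: `theorem foo : Summit.AtomisticToContinuum.BoseEinsteinCondensation.Theses.NumberFilterBlindness.<Decl> := …` in Summits/AtomisticToContinuum/BoseEinsteinCondensation/Theorems/<Name>.lean.
-/

namespace Summit.AtomisticToContinuum.BoseEinsteinCondensation.Theses.NumberFilterBlindness

open scoped BigOperators Topology Manifold Classical MeasureTheory ProbabilityTheory Matrix InnerProductSpace ComplexConjugate ContinuousMap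
open Filter Set Function TopologicalSpace MeasureTheory

attribute [summit_statement] _root_.BoseEinsteinCondensation

/-- item stmt-AtomisticToContinuum-6039 · target · rank 0 · closed · moot by None · by planner
why it might fail: C must not depend on ρ: if the slab-count concentration of near-minimisers forced a ρ-dependent filter geometry the bound would degrade to C(ρ)N/L² ~ N^{1/3+}; for v = 0 X holds by explicit product states, so only the interacting uniformity can fail.
sources: LSSY2005, LiebSolovej2001, Junge2026, Fournais2020, MuellerEtAl2006
[target] X as in § Thesis: per v (repulsive, finite range) and per c > 0, constants C (independent
of ρ, N) and ρ₀ such that for ρ < ρ₀ and all large N some Dirichlet trial state on the box of side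
(N/ρ)^{1/3} has energy ≤ E₀ + C·N/L² and λ_max(γ) ≤ cN (card item N1, mode-free form). -/
@[route_item "route-AtomisticToContinuum-NumberFilterBlindness"]
def JosephsonScaleBlindness : Prop :=
  ∀ v : ℝ → ENNReal, Literature.MathematicalPhysics.QuantumManyBody.BoseGas.IsRepulsiveFiniteRange v → ∀ c : ℝ, 0 < c → ∃ C ρ₀ : ℝ, 0 < ρ₀ ∧ ∀ ρ : ℝ, 0 < ρ → ρ < ρ₀ → ∀ᶠ N : ℕ in Filter.atTop, ∃ Φ : Literature.MathematicalPhysics.QuantumManyBody.BoseGas.TrialState N (Literature.MathematicalPhysics.QuantumManyBody.BoseGas.sideLength ρ N), Literature.MathematicalPhysics.QuantumManyBody.BoseGas.energy v Φ ≤ Literature.MathematicalPhysics.QuantumManyBody.BoseGas.groundStateEnergy v N (Literature.MathematicalPhysics.QuantumManyBody.BoseGas.sideLength ρ N) + ENNReal.ofReal (C * N / Literature.MathematicalPhysics.QuantumManyBody.BoseGas.sideLength ρ N ^ 2) ∧ Literature.MathematicalPhysics.QuantumManyBody.BoseGas.maxOccupation N Φ.ψ ≤ ENNReal.ofReal (c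 * N)

/-- item stmt-AtomisticToContinuum-6040 · crux · rank 2 · closed · moot by None · by planner
why it might fail: λ_max is bounded through the cell/layer LOADS of Φ: windows pin cell loads pointwise but layer loads only via Markov, jointly with the energy excess and window balance (weights 1/4+1/4+K⁻²<1); if the layer population could not be made ≤ εN at width L/K for concentrated Ψ, c < 4ε is out of reach.
sources: LiebSolovej2001, LSSY2005, CyconEtAl1987, Lewin2011, MuellerEtAl2006, Leggett2001
[crux] THE NUMBER-FILTER LEMMA (card mechanism; scale-free, model-free). For every c > 0 there are K
∈ ℕ and C ≥ 0 such that for every repulsive finite-range v, every N, every L > 0 and every Dirichlet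
trial state Ψ on Λ_L whose slab counts are concentrated — the |Ψ|²-probability that one of the K
slabs {x : x₁ ∈ [iL/K,(i+1)L/K)} holds more than 4N/K particles is ≤ 1/K² — and every slack δ with
⟨Ψ,HΨ⟩ ≤ E₀(N,L) + δ, there is a Dirichlet trial state Φ with ⟨Φ,HΦ⟩ ≤ E₀(N,L) + 4δ + C·N/L² and
λ_max(γ_Φ) ≤ cN. Construction: M = ⌈12/c⌉ cells (blocks of slabs) separated by single-slab layers,
smooth partition χ_c (Σ_c χ_c = 1, |∇χ_c| ≤ C₀K/L), smooth counts Ñ_c = Σ_j χ_c(x_j), joint filter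
F_k = Π_c f_{k_c}(Ñ_c) with Σ_k f_k² = 1, supp f_k of width 0.9 < 1, Σ_k f_k'² bounded; pointwise
IMS: Σ_k |∇(F_kΨ)|² = |∇Ψ|² + (Σ_k|∇F_k|²)|Ψ|², Σ_k|∇F_k|² ≤ C K²N/L²; Markov selection of one
window k (excess energy ≤ 4(δ + cost): weight 1/4; layer load ≤ 4·E_Ψ: weight 1/4; unbalanced
windows: weight ≤ 1/K²); in Φ = F_kΨ/‖F_kΨ‖ the coherence between distinct cell interiors vanishes
identically (f(n)f(n+1) = 0, pointwise in the other coordinates), cell loads are ≤ cN/2 on the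
support, layer load ≤ εN i -/
@[route_item "route-AtomisticToContinuum-NumberFilterBlindness"]
def FilterFragmentation : Prop :=
  ∀ c : ℝ, 0 < c → ∃ K : ℕ, ∃ C : ℝ, 0 < K ∧ 0 ≤ C ∧ ∀ v : ℝ → ENNReal, Literature.MathematicalPhysics.QuantumManyBody.BoseGas.IsRepulsiveFiniteRange v → ∀ (N : ℕ) (L : ℝ), 0 < L → ∀ Ψ : Literature.MathematicalPhysics.QuantumManyBody.BoseGas.TrialState N L, (∫⁻ X in {X : Literature.MathematicalPhysics.QuantumManyBody.BoseGas.Config N | ∃ i : Fin K, 4 * (N : ℝ) / K < ((Finset.univ.filter fun j : Fin N => X j 0 ∈ Set.Ico (((i : ℕ) : ℝ) * L / K) ((((i : ℕ) : ℝ) + 1) * L / K)).card : ℝ)}, (‖Ψ.ψ X‖₊ : ENNReal) ^ 2) ≤ ENNReal.ofReal (1 / (K : ℝ) ^ 2) → ∀ δ : ENNReal, Literature.MathematicalPhysics.QuantumManyBody.BoseGas.energy v Ψ ≤ Literature.MathematicalPhysics.QuantumManyBody.BoseGas.groundStateEnergy v N L + δ → ∃ Φ : Literature.MathematicalPhysics.QuantumManyBody.BoseGas.TrialState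 N L, Literature.MathematicalPhysics.QuantumManyBody.BoseGas.energy v Φ ≤ Literature.MathematicalPhysics.QuantumManyBody.BoseGas.groundStateEnergy v N L + 4 * δ + ENNReal.ofReal (C * N / L ^ 2) ∧ Literature.MathematicalPhysics.QuantumManyBody.BoseGas.maxOccupation N Φ.ψ ≤ ENNReal.ofReal (c * N)

/-- item stmt-AtomisticToContinuum-6041 · crux · rank 3 · closed · moot by None · by planner
why it might fail: Needs E₀^Dir ≤ 4πaρN(1+o(1)) (only periodic Thm 2.2 is in tree), a SECOND-MOMENT form of the LY cell bound incl. cubes with n ≫ p particles (superadditivity blocks) and the a = 0 reduction; false if near-minimisers at slack N/L² can be Schrödinger cats of macroscopically different profiles.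
sources: LSSY2005, LiebYngvason1998, Dyson1957, LiebSeiringerSolovejYngvason2005
[crux] For every repulsive finite-range v and every K ≥ 1 there is ρ₀ > 0 such that for 0 < ρ < ρ₀
and all large N there is a Dirichlet trial state Ψ on the box of side L = (N/ρ)^{1/3} with ⟨Ψ,HΨ⟩ ≤
E₀ + N/L² whose slab counts are concentrated in the sense of FilterFragmentation (|Ψ|²-probability
that some slab of width L/K along x₁ holds > 4N/K particles is ≤ 1/K²). Route to it: for a > 0, ANY
Ψ with slack N/L² has energy ≤ 4πaρN(1+ε) (DirichletUpperBound; N/L² = o(ρaN)), while the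
state-level cell decomposition into K³ Neumann cubes of side ℓ = L/K (in tree:
sum_locGroundStateEnergy_mul_le_setLIntegral_cellSet pattern) gives energy ≥ E_Ψ[Σ_cubes E₀^Neu(n_c,
ℓ)] with, per cube, LSSY Thm 2.4 in Neumann form (LSSY2005_lowerBound_neumann_holds: 4πa n_c²/ℓ³(1 −
CY_c^{1/17}) for n_min ≤ n_c ≤ Dn̄), superadditivity blocks for n_c > Dn̄
(LSSY2005_superadditivity.mul_le) and E₀ ≥ 0 for n_c < n_min ~ (ℓ/a)^{1/6} ≪ n̄ = N/K³; subtracting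
the tangent at n̄ leaves a Huber-type deviation Σ_c E_Ψ min((n_c−n̄)², Dn̄|n_c−n̄|) ≤ C(ε + Y^{1/17}
+ o(1))·N n̄, and Chebyshev gives the slab statement once C(ε + Y^{1/17})K⁵ is small (ρ < ρ₀(K, v),
N large); for a = 0 (v = 0 a.e., free functional) take t -/
@[route_item "route-AtomisticToContinuum-NumberFilterBlindness"]
def NearMinimiserSlabConcentration : Prop :=
  ∀ v : ℝ → ENNReal, Literature.MathematicalPhysics.QuantumManyBody.BoseGas.IsRepulsiveFiniteRange v → ∀ K : ℕ, 0 < K → ∃ ρ₀ : ℝ, 0 < ρ₀ ∧ ∀ ρ : ℝ, 0 < ρ → ρ < ρ₀ → ∀ᶠ N : ℕ in Filter.atTop, ∃ Ψ : Literature.MathematicalPhysics.QuantumManyBody.BoseGas.TrialState N (Literature.MathematicalPhysics.QuantumManyBody.BoseGas.sideLength ρ N), Literature.MathematicalPhysics.QuantumManyBody.BoseGas.energy v Ψ ≤ Literature.MathematicalPhysics.QuantumManyBody.BoseGas.groundStateEnergy v N (Literature.MathematicalPhysics.QuantumManyBody.BoseGas.sideLength ρ N) + ENNReal.ofReal (N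 / Literature.MathematicalPhysics.QuantumManyBody.BoseGas.sideLength ρ N ^ 2) ∧ (∫⁻ X in {X : Literature.MathematicalPhysics.QuantumManyBody.BoseGas.Config N | ∃ i : Fin K, 4 * (N : ℝ) / K < ((Finset.univ.filter fun j : Fin N => X j 0 ∈ Set.Ico (((i : ℕ) : ℝ) * Literature.MathematicalPhysics.QuantumManyBody.BoseGas.sideLength ρ N / K) ((((i : ℕ) : ℝ) + 1) * Literature.MathematicalPhysics.QuantumManyBody.BoseGas.sideLength ρ N / K)).card : ℝ)}, (‖Ψ.ψ X‖₊ : ENNReal) ^ 2) ≤ ENNReal.ofReal (1 / (K : ℝ) ^ 2)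

/-- item stmt-AtomisticToContinuum-6042 · crux · rank 5 · closed · moot by None · by planner
why it might fail: It is thermodynamic-limit BEC uniformly over all κN/L²-near-minimisers — stronger than the conjunct (δ chosen after N); no kinetic gap survives L → ∞ (ChongLiangNam2026 §1), and a soft non-phonon branch re-condensing ⊥ the condensate at cost o(N/L²) would refute every κ > 0.
sources: Junge2026, FournaisEtAl2024, LiebSeiringer2002, NamRougerieSeiringer2016, ChongLiangNam2026, LSSY2005
[crux] POSITIVE FACE of the dichotomy (not used by the Assembly): for every repulsive finite-range v
there is ρ₀ > 0 such that for 0 < ρ < ρ₀ there are c, κ > 0 with: for all large N, EVERY Dirichlet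
trial state Ψ on the box of side L = (N/ρ)^{1/3} with ⟨Ψ,HΨ⟩ ≤ E₀ + κN/L² has λ_max(γ_Ψ) ≥ cN.
Together with X this pins the threshold of energy-only condensation criteria at exactly the
Josephson scale (κ small: condensation; C(c) large: fragmentation). Implied by
BECPinning.PinnedLowerBound; implies the conjunct (SlackCondensationToBEC). Filed so that future
energy-currency routes attach to ONE deduplicated statement of the right shape. [difficulty:
open-problem] -/
@[route_item "route-AtomisticToContinuum-NumberFilterBlindness"]
def JosephsonSlackCondensation : Prop :=
  ∀ v : ℝ → ENNReal, Literature.MathematicalPhysics.QuantumManyBody.BoseGas.IsRepulsiveFiniteRange v → ∃ ρ₀ : ℝ, 0 < ρ₀ ∧ ∀ ρ : ℝ, 0 < ρ → ρ < ρ₀ → ∃ c κ : ℝ, 0 < c ∧ 0 < κ ∧ ∀ᶠ N : ℕ in Filter.atTop, ∀ Ψ : Literature.MathematicalPhysics.QuantumManyBody.BoseGas.TrialState N (Literature.MathematicalPhysics.QuantumManyBody.BoseGas.sideLength ρ N), Literature.MathematicalPhysics.QuantumManyBody.BoseGas.energy v Ψ ≤ Literature.MathematicalPhysics.QuantumManyBody.BoseGas.groundStateEnergy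 v N (Literature.MathematicalPhysics.QuantumManyBody.BoseGas.sideLength ρ N) + ENNReal.ofReal (κ * N / Literature.MathematicalPhysics.QuantumManyBody.BoseGas.sideLength ρ N ^ 2) → ENNReal.ofReal (c * N) ≤ Literature.MathematicalPhysics.QuantumManyBody.BoseGas.maxOccupation N Ψ.ψ

/-- item stmt-AtomisticToContinuum-6043 · support · rank 9 · closed · moot by None · by planner
sources: LSSY2005, LiebSeiringerSolovejYngvason2005
[support] JosephsonSlackCondensation → BoseEinsteinCondensation: with δ := ofReal(κN/L²) > 0 (N ≥ 1)
apply Literature.MathematicalPhysics.QuantumManyBody.BoseGas.le_condensateNumber to get ofReal(cN) ≤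
condensateNumber, i.e. HasGroundStateBEC v ρ with the same c (~30 lines). [difficulty: provable-now] -/
@[route_item "route-AtomisticToContinuum-NumberFilterBlindness"]
def SlackCondensationToBEC : Prop :=
  JosephsonSlackCondensation → Literature.MathematicalPhysics.QuantumManyBody.BoseGas.BoseEinsteinCondensation

/-- item stmt-AtomisticToContinuum-6044 · support · rank 9 · closed · moot by None · by planner
sources: LSSY2005, Dyson1957, LiebSeiringerSolovejYngvason2005
[support] Leading-order Dirichlet upper bound in the thermodynamic limit: for repulsive finite-range
v with 0 < a < ∞ (a = scattering length) and every ε > 0 there is ρ₀ > 0 such that for 0 < ρ < ρ₀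
and all large N, E₀^Dir(N, (N/ρ)^{1/3}) ≤ 4πaρN(1+ε). From the in-tree periodic Thm 2.2
(LSSY2005_upperBound_periodic_holds: 4πρ₁a(1 + C a/b), a/b ~ (ρa³)^{1/3}) or directly from Dyson's
trial state, times a product boundary cutoff Π_j h(x_j) vanishing on ∂Λ (h = 1 at distance b = o(L)
from the walls): the cutoff costs O(N/(bL) + Nb/L)·(ρa) = o(N) relative — LSSY (2.8): e₀(ρ) is
independent of boundary conditions. [difficulty: M] -/
@[route_item "route-AtomisticToContinuum-NumberFilterBlindness"]
def DirichletUpperBound : Prop :=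
  ∀ v : ℝ → ENNReal, Literature.MathematicalPhysics.QuantumManyBody.BoseGas.IsRepulsiveFiniteRange v → Literature.MathematicalPhysics.QuantumManyBody.BoseGas.scatteringLength v ≠ ⊤ → 0 < (Literature.MathematicalPhysics.QuantumManyBody.BoseGas.scatteringLength v).toReal → ∀ ε : ℝ, 0 < ε → ∃ ρ₀ : ℝ, 0 < ρ₀ ∧ ∀ ρ : ℝ, 0 < ρ → ρ < ρ₀ → ∀ᶠ N : ℕ in Filter.atTop, Literature.MathematicalPhysics.QuantumManyBody.BoseGas.groundStateEnergy v N (Literature.MathematicalPhysics.QuantumManyBody.BoseGas.sideLength ρ N) ≤ ENNReal.ofReal (4 * Real.pi * (Literature.MathematicalPhysics.QuantumManyBody.BoseGas.scatteringLength v).toReal * ρ * N * (1 + ε))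

/-- item stmt-AtomisticToContinuum-6045 · assembly · rank 1 · closed · moot by None · by planner
sources: LSSY2005, LiebSolovej2001
[assembly] FilterFragmentation → NearMinimiserSlabConcentration → JosephsonScaleBlindness
(conclusion = the barrier statement X, by design). -/
@[route_item "route-AtomisticToContinuum-NumberFilterBlindness"]
def Assembly : Prop :=
  FilterFragmentation → NearMinimiserSlabConcentration → JosephsonScaleBlindness

end Summit.AtomisticToContinuum.BoseEinsteinCondensation.Theses.NumberFilterBlindness
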